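import Summits.SmoothPoincare4.SmoothPoincare4.Theorems.SymplecticOrigamiGromovRecognitionRelEndHelperDetFrameIdentity
import Mathlib.Analysis.InnerProductSpace.PiL2

/-!
# Crossing algebra: the normal-pairing determinant versus the frame determinant
(registered helper `helper_nwtCrossingAlgebra` of the stub `stub_normalWitnessTransfer`, line
`cross-cap-laurent`, crux `GromovRecognitionRelEnd`, item stmt-SmoothPoincare4-11009)

Pointwise linear algebra at a transverse crossing of two surfaces in a `4`-manifold, read in a
Whitney embedding.  Data: `E = ℝ⁴` (the tangent space) with a basis `b`, `W = ℝᵐ`,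
`de : E → W`, an idempotent `Q : W → W` (the normal projection of the first surface), an
orthogonal pair `τ, τ'` of equal nonzero length fixed by `Q`, vectors `N₁ N₂ : E` with
`de N₁ = τ`, `de N₂ = τ'`, the tangent frame `α : ℂ → E` of the first surface (`Q ∘ de ∘ α = 0`),
the tangent frame `β : ℂ → E` of the second surface `{g = s}` and `μ = dg` (`μ ∘ β = 0`) with a
right inverse `L`.  Claim (`helper_nwtCrossingAlgebra`): with the pairing determinant
`d = ⟪Q de β1, τ⟫ ⟪Q de βI, τ'⟫ - ⟪Q de βI, τ⟫ ⟪Q de β1, τ'⟫`,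
`d · b.det (α 1, α I, N₁, N₂) = ‖τ‖⁴ · (b.det (β 1, β I, L 1, L I) · det (μ ∘ α))`.

Proof: a direct specialisation of the frame-determinant identity `helper_detFrameIdentity`
(elementary exterior algebra, N. Bourbaki, *Algebra I*, Chapter III, §8, Prop. 12) to
`lam ξ = ⟪Q de ξ, τ⟫ + ⟪Q de ξ, τ'⟫ I` and the rescaled normal frame
`N c = (Re c / ‖τ‖²) N₁ + (Im c / ‖τ‖²) N₂`, for which `lam ∘ α = 0` and `lam ∘ N = id`
(orthogonality and `‖τ'‖ = ‖τ‖`).  The determinant of the real-linear self-map `lam ∘ β` of `ℂ`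
is `d` (`det_realLinear_complex_eq`), the frame determinant is homogeneous of degree two in its
last two slots, and clearing the denominator `‖τ‖⁴` gives the claim.
No new definitions.
-/

-- the prescribed namespace `Summit.<P>.<Sub>.…` duplicates `SmoothPoincare4` (P = Sub)
set_option linter.dupNamespace false

open Module

namespace Summit.SmoothPoincare4.SmoothPoincare4.Theorems.GromovRecognitionRelEnd.CrossCapLaurent

namespace HelperNwtCrossingAlgebra

variable {E : Type*} [AddCommGroup E] [Module ℝ E]

/-- Homogeneity of an alternating `4`-form in its last two slots:
`f (p, q, r • n, r • m) = r² f (p, q, n, m)`. [folklore] -/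
theorem four_form_smul_last_two (f : E [⋀^Fin 4]→ₗ[ℝ] ℝ) (p q n m : E) (r : ℝ) :
    f ![p, q, r • n, r • m] = r * r * f ![p, q, n, m] := by
  set g : E [⋀^Fin 2]→ₗ[ℝ] ℝ := (f.curryLeft p).curryLeft q with hg
  have hfg : ∀ x y : E, f ![p, q, x, y] = g ![x, y] := fun x y => rfl
  have hsmul : ∀ (x y : E) (s : ℝ), g ![x, s • y] = s • g ![x, y] := fun x y s =>
    (g.curryLeft x).map_vecCons_smul ![] s y
  rw [hfg, hfg, g.map_vecCons_smul, hsmul, smul_eq_mul, smul_eq_mul]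
  ring

end HelperNwtCrossingAlgebra

open HelperNwtCrossingAlgebra HelperDetFrameIdentity in
/-- **Crossing algebra.**  At a transverse crossing, with `Q` the normal projection of the first
surface, `τ, τ' = de N₁, de N₂` an orthogonal normal frame of equal nonzero length fixed by `Q`,
`α` the tangent frame of the first surface (`Q de α = 0`), `β` the tangent frame of the second
surface and `μ` (`μ β = 0`) with right inverse `L`: the pairing determinant
`⟪Q de β1, τ⟫ ⟪Q de βI, τ'⟫ - ⟪Q de βI, τ⟫ ⟪Q de β1, τ'⟫` times `b.det (α 1, α I, N₁, N₂)` equals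
`‖τ‖⁴ · (b.det (β 1, β I, L 1, L I) · det (μ ∘ α))`. -/
theorem helper_nwtCrossingAlgebra : ∀ (m : ℕ) (b : Module.Basis (Fin 4) ℝ (EuclideanSpace ℝ (Fin 4))) (de : EuclideanSpace ℝ (Fin 4) →L[ℝ] EuclideanSpace ℝ (Fin m)) (Q : EuclideanSpace ℝ (Fin m) →L[ℝ] EuclideanSpace ℝ (Fin m)) (τ τ' : EuclideanSpace ℝ (Fin m)) (N₁ N₂ : EuclideanSpace ℝ (Fin 4)) (α β L : ℂ →L[ℝ] EuclideanSpace ℝ (Fin 4)) (μ : EuclideanSpace ℝ (Fin 4) →L[ℝ] ℂ), (∀ v, Q (Q v) = Q v) → Q τ = τ → Q τ' = τ' → inner ℝ τ' τ = 0 → ‖τ'‖ = ‖τ‖ → τ ≠ 0 → de N₁ = τ → de N₂ = τ' → (∀ h, Q (de (α h)) = 0) → (∀ h, μ (β h) = 0) → (∀ c, μ (L c) = c) → (inner ℝ (Q (de (β 1))) τ * inner ℝ (Q (de (β Complex.I))) τ' - inner ℝ (Q (de (β Complex.I))) τ * inner ℝ (Q (de (β 1))) τ') * b.det ![α 1, α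 Complex.I, N₁, N₂] = ‖τ‖ ^ 4 * (b.det ![β 1, β Complex.I, L 1, L Complex.I] * LinearMap.det ((μ.comp α : ℂ →L[ℝ] ℂ) : ℂ →ₗ[ℝ] ℂ)) := by
  intro m b de Q τ τ' N₁ N₂ α β L μ _hQQ hQτ hQτ' horth hnorm hτ hN₁ hN₂ hα hβ hL
  -- the scaling factor `r = 1 / ‖τ‖²`
  set r : ℝ := (‖τ‖ ^ 2)⁻¹ with hr
  have hτ0 : ‖τ‖ ≠ 0 := norm_ne_zero_iff.2 hτ
  have hr1 : ‖τ‖ ^ 2 * r = 1 := mul_inv_cancel₀ (pow_ne_zero 2 hτ0)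
  have horth' : inner ℝ τ τ' = 0 := by rw [real_inner_comm]; exact horth
  -- the complex-valued functional `lam = ⟪Q de ·, τ⟫ + ⟪Q de ·, τ'⟫ I`
  let lam : EuclideanSpace ℝ (Fin 4) →ₗ[ℝ] ℂ :=
    { toFun := fun ξ => ((inner ℝ (Q (de ξ)) τ : ℝ) : ℂ)
        + ((inner ℝ (Q (de ξ)) τ' : ℝ) : ℂ) * Complex.I
      map_add' := fun x y => by
        simp only [map_add, inner_add_left, Complex.ofReal_add]
        ring
      map_smul' := fun c x => by
        simp only [map_smul, real_inner_smul_left, Complex.ofReal_mul, RingHom.id_apply,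
          Complex.real_smul]
        ring }
  have hlam : ∀ ξ, lam ξ = ((inner ℝ (Q (de ξ)) τ : ℝ) : ℂ)
      + ((inner ℝ (Q (de ξ)) τ' : ℝ) : ℂ) * Complex.I := fun ξ => rfl
  have hlam_re : ∀ ξ, (lam ξ).re = inner ℝ (Q (de ξ)) τ := fun ξ => by
    rw [hlam]
    simp
  have hlam_im : ∀ ξ, (lam ξ).im = inner ℝ (Q (de ξ)) τ' := fun ξ => by
    rw [hlam]
    simp
  -- the rescaled normal frame `N c = Re c • r • N₁ + Im c • r • N₂`
  let N : ℂ →ₗ[ℝ] EuclideanSpace ℝ (Fin 4) :=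
    Complex.reLm.smulRight (r • N₁) + Complex.imLm.smulRight (r • N₂)
  have hN : ∀ c, N c = c.re • (r • N₁) + c.im • (r • N₂) := fun c => rfl
  have hN1 : N 1 = r • N₁ := by
    rw [hN]
    simp
  have hNI : N Complex.I = r • N₂ := by
    rw [hN]
    simp
  have hQdeN : ∀ c, Q (de (N c)) = c.re • (r • τ) + c.im • (r • τ') := fun c => by
    simp only [hN, map_add, map_smul, hN₁, hN₂, hQτ, hQτ']
  have hlamN : ∀ c, lam (N c) = c := fun c => by
    apply Complex.ext
    · rw [hlam_re, hQdeN]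
      simp only [inner_add_left, real_inner_smul_left, real_inner_self_eq_norm_sq, horth]
      linear_combination c.re * hr1
    · rw [hlam_im, hQdeN]
      simp only [inner_add_left, real_inner_smul_left, real_inner_self_eq_norm_sq, horth', hnorm]
      linear_combination c.im * hr1
  -- the four hypotheses of the frame-determinant identity
  have h1 : lam ∘ₗ (α : ℂ →ₗ[ℝ] EuclideanSpace ℝ (Fin 4)) = 0 := LinearMap.ext fun h => by
    rw [LinearMap.comp_apply, ContinuousLinearMap.coe_coe, hlam, hα, LinearMap.zero_apply]
    simp
  have h2 : lam ∘ₗ N = LinearMap.id := LinearMap.ext fun c => by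
    rw [LinearMap.comp_apply, hlamN, LinearMap.id_apply]
  have h3 : (μ : EuclideanSpace ℝ (Fin 4) →ₗ[ℝ] ℂ) ∘ₗ (β : ℂ →ₗ[ℝ] EuclideanSpace ℝ (Fin 4)) = 0 :=
    LinearMap.ext fun h => by simp [hβ]
  have h4 : (μ : EuclideanSpace ℝ (Fin 4) →ₗ[ℝ] ℂ) ∘ₗ (L : ℂ →ₗ[ℝ] EuclideanSpace ℝ (Fin 4))
      = LinearMap.id :=
    LinearMap.ext fun c => by simp [hL]
  have key := helper_detFrameIdentity (EuclideanSpace ℝ (Fin 4)) b α β N L lam μ h1 h2 h3 h4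
  -- read off the two determinants on the left
  have hdetlam : LinearMap.det (lam ∘ₗ (β : ℂ →ₗ[ℝ] EuclideanSpace ℝ (Fin 4)))
      = inner ℝ (Q (de (β 1))) τ * inner ℝ (Q (de (β Complex.I))) τ'
        - inner ℝ (Q (de (β Complex.I))) τ * inner ℝ (Q (de (β 1))) τ' := by
    rw [det_realLinear_complex_eq]
    simp only [LinearMap.coe_comp, Function.comp_apply, ContinuousLinearMap.coe_coe, hlam_re,
      hlam_im]
  have hdetN : b.det ![α 1, α Complex.I, N 1, N Complex.I]
      = r * r * b.det ![α 1, α Complex.I, N₁, N₂] := by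
    rw [hN1, hNI, four_form_smul_last_two]
  simp only [ContinuousLinearMap.coe_coe] at key
  rw [hdetlam, hdetN] at key
  rw [ContinuousLinearMap.toLinearMap_comp]
  linear_combination ‖τ‖ ^ 4 * key
    - (inner ℝ (Q (de (β 1))) τ * inner ℝ (Q (de (β Complex.I))) τ'
        - inner ℝ (Q (de (β Complex.I))) τ * inner ℝ (Q (de (β 1))) τ')
      * b.det ![α 1, α Complex.I, N₁, N₂] * (‖τ‖ ^ 2 * r + 1) * hr1

end Summit.SmoothPoincare4.SmoothPoincare4.Theorems.GromovRecognitionRelEnd.CrossCapLaurent
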